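import Literature.NumberTheory.Transcendental.KZDirichletCharts
import HarnessLib

/-!
# Kontsevich–Zagier's `ζ(2) = π²/6` inside the three rules, I: three rational charts

Kontsevich–Zagier (*Periods*, 2001, §1.2) single out the identity `ζ(2) = π²/6`, with
`ζ(2) = ∫∫_{0<x<y<1} dx dy / ((1-x) y)` (their eq. (2)), as the test case of their Conjecture 1,
and remark that it is "not obvious how to prove it using only the rules 1)–3)"; the proof they
sketch leaves the rules at its first step (the identification `∫∫ dxdy/((1-xy)√(xy)) = 3ζ(2)` is a
series expansion) and then uses Calabi's trigonometric substitution.  This file and its sequel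
(`SoloBlindZetaTwo`) realise the identity ENTIRELY inside the rules, by `ℚ`-RATIONAL changes of
variables in dimension two.  Here: the three charts, in the pinned style of
`KZ.exists_dirichletPolarChart` (map, derivative, semialgebraicity, injectivity, exact image,
Jacobian), and the generic lemmas turning a chart into (a) transport of absolute integrability and
(b) one change-of-variables move between representations pinned by domain and integrand.

* `exists_squareChart`: `(x,y) ↦ (x²,y²)`, triangle `T = {0<x<y<1}` onto itself, `|J| = 4xy`;
* `exists_halfSquareChart`: `(x,y) ↦ (x,y²)`, `T` onto `U = {0<x<1, x²<y<1}`, `|J| = 2y`;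
* (in `SoloBlindZetaTwoWedge`) `exists_wedgeChart`: `(x,y) ↦ (y/x, (1+y²)/(1+x²))`, wedge
  `W = {0<y<x}` onto `U`, under which `dxdy/((1+x²)(1+y²))` becomes `du dv/(2(1-u²)v)`.

References: M. Kontsevich, D. Zagier, *Periods* (2001), §1.2 (rules (1)–(3), eq. (2), the
`ζ(2)` discussion).
-/

noncomputable section

namespace Summit.KontsevichZagierPeriods.KontsevichZagierPeriods.Theorems

open Set MeasureTheory
open Literature.ModelTheory.ExponentialFields (IsSemialgebraic isSemialgebraic_setOf_eval_pos)
open Literature.NumberTheory.Transcendental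
open Literature.NumberTheory.Transcendental.KZ

namespace SoloBlind

/-! ## Charts transport integrability and give one move -/

/-- **Transport of integrability along a chart** (Mathlib's Jacobian criterion, repackaged): if
`Φ` is injective on a measurable `S` with derivative `Φ'`, `|det Φ'| = J` on `S` and
`f = (g ∘ Φ) · J` on `S`, then `g` is integrable on `Φ '' S` iff `f` is integrable on `S`. -/
theorem integrableOn_iff_of_chart {n : ℕ} {S : Set (Fin n → ℝ)} (hS : MeasurableSet S)
    {Φ : (Fin n → ℝ) → (Fin n → ℝ)} {Φ' : (Fin n → ℝ) → (Fin n → ℝ) →L[ℝ] (Fin n → ℝ)}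
    {J f g : (Fin n → ℝ) → ℝ} (hderiv : ∀ z ∈ S, HasFDerivAt Φ (Φ' z) z) (hinj : InjOn Φ S)
    (hdet : ∀ z ∈ S, |(Φ' z).det| = J z) (hfg : ∀ z ∈ S, f z = g (Φ z) * J z) :
    IntegrableOn g (Φ '' S) ↔ IntegrableOn f S := by
  rw [integrableOn_image_iff_integrableOn_abs_det_fderiv_smul volume hS
    (fun x hx => (hderiv x hx).hasFDerivWithinAt) hinj]
  exact integrableOn_congr_fun (fun z hz => by rw [smul_eq_mul, hdet z hz, hfg z hz, mul_comm]) hS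

/-- **One change-of-variables move along a chart** (Kontsevich–Zagier's rule (2)): with the chart
data as above, `ℚ`-semialgebraic on `S` and with image exactly `S'`, a representation pinned as
`[S, f]` is equivalent to a representation pinned as `[S', g]`. -/
theorem equivalent_of_chart {n : ℕ} {S S' : Set (Fin n → ℝ)}
    {Φ : (Fin n → ℝ) → (Fin n → ℝ)} {Φ' : (Fin n → ℝ) → (Fin n → ℝ) →L[ℝ] (Fin n → ℝ)}
    {J f g : (Fin n → ℝ) → ℝ} (hsa : IsSemialgebraicMapOn ℚ S Φ)
    (hderiv : ∀ z ∈ S, HasFDerivAt Φ (Φ' z) z) (hinj : InjOn Φ S) (himage : Φ '' S = S')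
    (hdet : ∀ z ∈ S, |(Φ' z).det| = J z) (hfg : ∀ z ∈ S, f z = g (Φ z) * J z)
    {r r' : IntegralRep n} (hrd : r.domain = S) (hri : EqOn r.integrand f S)
    (hr'd : r'.domain = S') (hr'i : EqOn r'.integrand g S') : Equivalent r r' := by
  subst hrd hr'd
  refine changeOfVariablesRel_subset_relations ⟨n, r, r', Φ, Φ', hsa,
    fun x hx => (hderiv x hx).hasFDerivWithinAt, hinj, himage.symm, fun z hz => ?_, rfl⟩
  have hΦz : Φ z ∈ r'.domain := himage ▸ mem_image_of_mem Φ hz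
  rw [hri hz, hr'i hΦz, hdet z hz, hfg z hz]

/-! ## The three planar domains -/

/-- Kontsevich–Zagier's triangle `T = {0 < x < y < 1}` (the domain of their eq. (2)). -/
def kzTriangle : Set (Fin 2 → ℝ) := {z | 0 < z 0 ∧ z 0 < z 1 ∧ z 1 < 1}

/-- The region `U = {0 < x < 1, x² < y < 1}` under the parabola. -/
def kzParabolic : Set (Fin 2 → ℝ) := {z | 0 < z 0 ∧ z 0 < 1 ∧ z 0 ^ 2 < z 1 ∧ z 1 < 1}

/-- The open wedge `W = {0 < y < x}`. -/
def kzWedge : Set (Fin 2 → ℝ) := {z | 0 < z 1 ∧ z 1 < z 0}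

/-- Membership in `T`, unfolded. -/
theorem mem_kzTriangle {z : Fin 2 → ℝ} : z ∈ kzTriangle ↔ 0 < z 0 ∧ z 0 < z 1 ∧ z 1 < 1 :=
  Iff.rfl

/-- Membership in `U`, unfolded. -/
theorem mem_kzParabolic {z : Fin 2 → ℝ} :
    z ∈ kzParabolic ↔ 0 < z 0 ∧ z 0 < 1 ∧ z 0 ^ 2 < z 1 ∧ z 1 < 1 :=
  Iff.rfl

/-- Membership in `W`, unfolded. -/
theorem mem_kzWedge {z : Fin 2 → ℝ} : z ∈ kzWedge ↔ 0 < z 1 ∧ z 1 < z 0 := Iff.rfl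

/-- `T` is `ℚ`-semialgebraic. -/
theorem isSemialgebraic_kzTriangle : IsSemialgebraic ℚ kzTriangle := by
  have h := isSemialgebraic_setOf_forall_aeval_pos
    ![MvPolynomial.X 0, MvPolynomial.X 1 - MvPolynomial.X 0, (1 - MvPolynomial.X 1 : MvPolynomial (Fin 2) ℚ)]
  convert h using 1
  ext x
  simp only [kzTriangle, mem_setOf_eq, Fin.forall_fin_succ, Matrix.cons_val_zero,
    Matrix.cons_val_succ, map_sub, map_one, MvPolynomial.aeval_X, sub_pos]
  exact ⟨fun ⟨h0, h1, h2⟩ => ⟨h0, h1, h2, fun i => Fin.elim0 i⟩, fun ⟨h0, h1, h2, _⟩ => ⟨h0, h1, h2⟩⟩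

/-- `U` is `ℚ`-semialgebraic. -/
theorem isSemialgebraic_kzParabolic : IsSemialgebraic ℚ kzParabolic := by
  have h := isSemialgebraic_setOf_forall_aeval_pos
    ![MvPolynomial.X 0, 1 - MvPolynomial.X 0, MvPolynomial.X 1 - MvPolynomial.X 0 ^ 2,
      (1 - MvPolynomial.X 1 : MvPolynomial (Fin 2) ℚ)]
  convert h using 1
  ext x
  simp only [kzParabolic, mem_setOf_eq, Fin.forall_fin_succ, Matrix.cons_val_zero,
    Matrix.cons_val_succ, map_sub, map_one, map_pow, MvPolynomial.aeval_X, sub_pos]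
  exact ⟨fun ⟨h0, h1, h2, h3⟩ => ⟨h0, h1, h2, h3, fun i => Fin.elim0 i⟩,
    fun ⟨h0, h1, h2, h3, _⟩ => ⟨h0, h1, h2, h3⟩⟩

/-- `W` is `ℚ`-semialgebraic. -/
theorem isSemialgebraic_kzWedge : IsSemialgebraic ℚ kzWedge := by
  have h := isSemialgebraic_setOf_forall_aeval_pos
    ![MvPolynomial.X 1, (MvPolynomial.X 0 - MvPolynomial.X 1 : MvPolynomial (Fin 2) ℚ)]
  convert h using 1
  ext x
  simp only [kzWedge, mem_setOf_eq, Fin.forall_fin_succ, Matrix.cons_val_zero,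
    Matrix.cons_val_succ, map_sub, MvPolynomial.aeval_X, sub_pos]
  exact ⟨fun ⟨h0, h1⟩ => ⟨h0, h1, fun i => Fin.elim0 i⟩, fun ⟨h0, h1, _⟩ => ⟨h0, h1⟩⟩

/-- `T` is measurable. -/
theorem measurableSet_kzTriangle : MeasurableSet kzTriangle :=
  isSemialgebraic_kzTriangle.measurableSet_holds

/-- `U` is measurable. -/
theorem measurableSet_kzParabolic : MeasurableSet kzParabolic :=
  isSemialgebraic_kzParabolic.measurableSet_holds

/-- `W` is measurable. -/
theorem measurableSet_kzWedge : MeasurableSet kzWedge :=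
  isSemialgebraic_kzWedge.measurableSet_holds

/-! ## Chart 1: `(x, y) ↦ (x², y²)` on the triangle -/

/-- **The square chart** `Φ(x,y) = (x², y²)`: a `ℚ`-polynomial map of `T` ONTO `T`, injective,
with `|det DΦ| = 4xy`. -/
theorem exists_squareChart :
    ∃ (Φ : (Fin 2 → ℝ) → (Fin 2 → ℝ)) (Φ' : (Fin 2 → ℝ) → (Fin 2 → ℝ) →L[ℝ] (Fin 2 → ℝ)),
      (∀ z, Φ z 0 = z 0 ^ 2) ∧ (∀ z, Φ z 1 = z 1 ^ 2) ∧
      IsSemialgebraicMapOn ℚ kzTriangle Φ ∧ (∀ z ∈ kzTriangle, HasFDerivAt Φ (Φ' z) z) ∧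
      InjOn Φ kzTriangle ∧ Φ '' kzTriangle = kzTriangle ∧
      (∀ z ∈ kzTriangle, |(Φ' z).det| = 4 * z 0 * z 1) := by
  set Φ : (Fin 2 → ℝ) → (Fin 2 → ℝ) := fun z => ![z 0 ^ 2, z 1 ^ 2] with hΦ
  set Φ' : (Fin 2 → ℝ) → (Fin 2 → ℝ) →L[ℝ] (Fin 2 → ℝ) :=
    fun z => LinearMap.toContinuousLinearMap (Matrix.toLin' !![2 * z 0, 0; 0, 2 * z 1]) with hΦ'
  have hΦ0 : ∀ z, Φ z 0 = z 0 ^ 2 := fun z => rfl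
  have hΦ1 : ∀ z, Φ z 1 = z 1 ^ 2 := fun z => rfl
  have hΦ'0 : ∀ z v : Fin 2 → ℝ, Φ' z v 0 = 2 * z 0 * v 0 := by
    intro z v
    change Matrix.toLin' !![2 * z 0, 0; 0, 2 * z 1] v 0 = _
    rw [Matrix.toLin'_apply]
    simp [Matrix.mulVec, dotProduct, Fin.sum_univ_two]
  have hΦ'1 : ∀ z v : Fin 2 → ℝ, Φ' z v 1 = 2 * z 1 * v 1 := by
    intro z v
    change Matrix.toLin' !![2 * z 0, 0; 0, 2 * z 1] v 1 = _
    rw [Matrix.toLin'_apply]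
    simp [Matrix.mulVec, dotProduct, Fin.sum_univ_two]
  have hdet : ∀ z, (Φ' z).det = 4 * z 0 * z 1 := by
    intro z
    change LinearMap.det (Matrix.toLin' !![2 * z 0, 0; 0, 2 * z 1]) = _
    rw [LinearMap.det_toLin', Matrix.det_fin_two]
    simp only [Matrix.of_apply, Matrix.cons_val', Matrix.cons_val_zero, Matrix.cons_val_one,
      Matrix.cons_val_fin_one, Matrix.empty_val']
    ring
  have hderiv : ∀ z, HasFDerivAt Φ (Φ' z) z := by
    intro z
    have h0 : HasFDerivAt (fun y : Fin 2 → ℝ => y 0)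
        (ContinuousLinearMap.proj (R := ℝ) (φ := fun _ : Fin 2 => ℝ) 0) z := hasFDerivAt_apply 0 z
    have h1 : HasFDerivAt (fun y : Fin 2 → ℝ => y 1)
        (ContinuousLinearMap.proj (R := ℝ) (φ := fun _ : Fin 2 => ℝ) 1) z := hasFDerivAt_apply 1 z
    rw [hasFDerivAt_pi']
    refine Fin.forall_fin_two.mpr ⟨?_, ?_⟩
    · have hf : (fun y : Fin 2 → ℝ => Φ y 0) = fun y => y 0 * y 0 :=
        funext fun y => by rw [hΦ0, pow_two]
      rw [hf]
      refine (h0.mul h0).congr_fderiv (ContinuousLinearMap.ext fun v => ?_)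
      simp [hΦ'0]
      ring
    · have hf : (fun y : Fin 2 → ℝ => Φ y 1) = fun y => y 1 * y 1 :=
        funext fun y => by rw [hΦ1, pow_two]
      rw [hf]
      refine (h1.mul h1).congr_fderiv (ContinuousLinearMap.ext fun v => ?_)
      simp [hΦ'1]
      ring
  refine ⟨Φ, Φ', hΦ0, hΦ1, ?_, fun z _ => hderiv z, ?_, ?_, fun z hz => ?_⟩
  · convert isSemialgebraicMapOn_aeval isSemialgebraic_kzTriangle
      ![MvPolynomial.X 0 ^ 2, (MvPolynomial.X 1 ^ 2 : MvPolynomial (Fin 2) ℚ)] using 2 with z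
    funext i
    fin_cases i
    · simp [hΦ0]
    · simp [hΦ1]
  · intro x hx y hy hxy
    have e0 := congrFun hxy 0
    have e1 := congrFun hxy 1
    simp only [hΦ0, hΦ1] at e0 e1
    rw [mem_kzTriangle] at hx hy
    have f0 : (x 0 - y 0) * (x 0 + y 0) = 0 := by linear_combination e0
    have f1 : (x 1 - y 1) * (x 1 + y 1) = 0 := by linear_combination e1
    have h0 : x 0 = y 0 := by
      rcases mul_eq_zero.mp f0 with h | h
      · linarith
      · linarith [hx.1, hy.1]
    have h1 : x 1 = y 1 := by
      rcases mul_eq_zero.mp f1 with h | h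
      · linarith
      · linarith [hx.1, hy.1, hx.2.1, hy.2.1]
    funext i
    fin_cases i
    · exact h0
    · exact h1
  · ext w
    constructor
    · rintro ⟨z, hz, rfl⟩
      rw [mem_kzTriangle] at hz ⊢
      obtain ⟨h0, h01, h1⟩ := hz
      simp only [hΦ0, hΦ1]
      exact ⟨by positivity, by nlinarith, by nlinarith⟩
    · intro hw
      rw [mem_kzTriangle] at hw
      obtain ⟨hw0, hw01, hw1⟩ := hw
      have hw1' : 0 < w 1 := hw0.trans hw01
      refine ⟨![Real.sqrt (w 0), Real.sqrt (w 1)], ?_, ?_⟩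
      · rw [mem_kzTriangle]
        refine ⟨Real.sqrt_pos.mpr hw0, Real.sqrt_lt_sqrt hw0.le hw01, ?_⟩
        change Real.sqrt (w 1) < 1
        rw [← Real.sqrt_one]
        exact Real.sqrt_lt_sqrt hw1'.le hw1
      · funext i
        fin_cases i
        · change Real.sqrt (w 0) ^ 2 = w 0
          exact Real.sq_sqrt hw0.le
        · change Real.sqrt (w 1) ^ 2 = w 1
          exact Real.sq_sqrt hw1'.le
  · rw [mem_kzTriangle] at hz
    rw [hdet]
    exact abs_of_pos (by nlinarith [mul_pos hz.1 (hz.1.trans hz.2.1)])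

/-! ## Chart 2: `(x, y) ↦ (x, y²)` from the triangle onto the parabolic region -/

/-- **The half-square chart** `Φ(x,y) = (x, y²)`: a `ℚ`-polynomial map of `T` ONTO `U`,
injective, with `|det DΦ| = 2y`. -/
theorem exists_halfSquareChart :
    ∃ (Φ : (Fin 2 → ℝ) → (Fin 2 → ℝ)) (Φ' : (Fin 2 → ℝ) → (Fin 2 → ℝ) →L[ℝ] (Fin 2 → ℝ)),
      (∀ z, Φ z 0 = z 0) ∧ (∀ z, Φ z 1 = z 1 ^ 2) ∧
      IsSemialgebraicMapOn ℚ kzTriangle Φ ∧ (∀ z ∈ kzTriangle, HasFDerivAt Φ (Φ' z) z) ∧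
      InjOn Φ kzTriangle ∧ Φ '' kzTriangle = kzParabolic ∧
      (∀ z ∈ kzTriangle, |(Φ' z).det| = 2 * z 1) := by
  set Φ : (Fin 2 → ℝ) → (Fin 2 → ℝ) := fun z => ![z 0, z 1 ^ 2] with hΦ
  set Φ' : (Fin 2 → ℝ) → (Fin 2 → ℝ) →L[ℝ] (Fin 2 → ℝ) :=
    fun z => LinearMap.toContinuousLinearMap (Matrix.toLin' !![1, 0; 0, 2 * z 1]) with hΦ'
  have hΦ0 : ∀ z, Φ z 0 = z 0 := fun z => rfl
  have hΦ1 : ∀ z, Φ z 1 = z 1 ^ 2 := fun z => rfl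
  have hΦ'0 : ∀ z v : Fin 2 → ℝ, Φ' z v 0 = v 0 := by
    intro z v
    change Matrix.toLin' !![1, 0; 0, 2 * z 1] v 0 = _
    rw [Matrix.toLin'_apply]
    simp [Matrix.mulVec, dotProduct, Fin.sum_univ_two]
  have hΦ'1 : ∀ z v : Fin 2 → ℝ, Φ' z v 1 = 2 * z 1 * v 1 := by
    intro z v
    change Matrix.toLin' !![1, 0; 0, 2 * z 1] v 1 = _
    rw [Matrix.toLin'_apply]
    simp [Matrix.mulVec, dotProduct, Fin.sum_univ_two]
  have hdet : ∀ z, (Φ' z).det = 2 * z 1 := by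
    intro z
    change LinearMap.det (Matrix.toLin' !![1, 0; 0, 2 * z 1]) = _
    rw [LinearMap.det_toLin', Matrix.det_fin_two]
    simp only [Matrix.of_apply, Matrix.cons_val', Matrix.cons_val_zero, Matrix.cons_val_one,
      Matrix.cons_val_fin_one, Matrix.empty_val']
    ring
  have hderiv : ∀ z, HasFDerivAt Φ (Φ' z) z := by
    intro z
    have h0 : HasFDerivAt (fun y : Fin 2 → ℝ => y 0)
        (ContinuousLinearMap.proj (R := ℝ) (φ := fun _ : Fin 2 => ℝ) 0) z := hasFDerivAt_apply 0 z
    have h1 : HasFDerivAt (fun y : Fin 2 → ℝ => y 1)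
        (ContinuousLinearMap.proj (R := ℝ) (φ := fun _ : Fin 2 => ℝ) 1) z := hasFDerivAt_apply 1 z
    rw [hasFDerivAt_pi']
    refine Fin.forall_fin_two.mpr ⟨?_, ?_⟩
    · have hf : (fun y : Fin 2 → ℝ => Φ y 0) = fun y => y 0 := funext fun y => by rw [hΦ0]
      rw [hf]
      refine h0.congr_fderiv (ContinuousLinearMap.ext fun v => ?_)
      simp [hΦ'0]
    · have hf : (fun y : Fin 2 → ℝ => Φ y 1) = fun y => y 1 * y 1 :=
        funext fun y => by rw [hΦ1, pow_two]
      rw [hf]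
      refine (h1.mul h1).congr_fderiv (ContinuousLinearMap.ext fun v => ?_)
      simp [hΦ'1]
      ring
  refine ⟨Φ, Φ', hΦ0, hΦ1, ?_, fun z _ => hderiv z, ?_, ?_, fun z hz => ?_⟩
  · convert isSemialgebraicMapOn_aeval isSemialgebraic_kzTriangle
      ![MvPolynomial.X 0, (MvPolynomial.X 1 ^ 2 : MvPolynomial (Fin 2) ℚ)] using 2 with z
    funext i
    fin_cases i
    · simp [hΦ0]
    · simp [hΦ1]
  · intro x hx y hy hxy
    have e0 := congrFun hxy 0
    have e1 := congrFun hxy 1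
    simp only [hΦ0, hΦ1] at e0 e1
    rw [mem_kzTriangle] at hx hy
    have f1 : (x 1 - y 1) * (x 1 + y 1) = 0 := by linear_combination e1
    have h1 : x 1 = y 1 := by
      rcases mul_eq_zero.mp f1 with h | h
      · linarith
      · linarith [hx.1, hy.1, hx.2.1, hy.2.1]
    funext i
    fin_cases i
    · exact e0
    · exact h1
  · ext w
    constructor
    · rintro ⟨z, hz, rfl⟩
      rw [mem_kzTriangle] at hz
      rw [mem_kzParabolic]
      obtain ⟨h0, h01, h1⟩ := hz
      simp only [hΦ0, hΦ1]
      exact ⟨h0, by linarith, by nlinarith, by nlinarith⟩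
    · intro hw
      rw [mem_kzParabolic] at hw
      obtain ⟨hw0, hw01, hw2, hw1⟩ := hw
      have hw1' : 0 < w 1 := lt_of_le_of_lt (sq_nonneg _) hw2
      refine ⟨![w 0, Real.sqrt (w 1)], ?_, ?_⟩
      · rw [mem_kzTriangle]
        refine ⟨hw0, ?_, ?_⟩
        · change w 0 < Real.sqrt (w 1)
          exact (Real.lt_sqrt hw0.le).mpr hw2
        · change Real.sqrt (w 1) < 1
          rw [← Real.sqrt_one]
          exact Real.sqrt_lt_sqrt hw1'.le hw1
      · funext i
        fin_cases i
        · rfl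
        · change Real.sqrt (w 1) ^ 2 = w 1
          exact Real.sq_sqrt hw1'.le
  · rw [mem_kzTriangle] at hz
    rw [hdet]
    exact abs_of_pos (by linarith [hz.1.trans hz.2.1])

end SoloBlind

end Summit.KontsevichZagierPeriods.KontsevichZagierPeriods.Theorems
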